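import Summits.BirchSwinnertonDyer.BirchSwinnertonDyer.Theorems.TeichmullerTwistDescentCellsByNameFromKato
import Summits.BirchSwinnertonDyer.BirchSwinnertonDyer.Theorems.EdixhovenFibreFiveSevenTwistDegreeStepFiveSevenLTwistAssembly
import Summits.BirchSwinnertonDyer.BirchSwinnertonDyer.Theorems.EdixhovenFibreFiveSevenNonEisensteinWitness
import HarnessLib

/-!
# Route `TeichmullerTwistDescent` (rev 2): PSMU (stmt-BirchSwinnertonDyer-22638), SCMU57 (22639), CORNER (23883),
# LOW (23884) GRANTED the TWO cite-only facts F″ (Kato) and Ihara³ (Diamond–Ribet) + modularity + the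
# Chebotarev non-Eisenstein witness — L-TWIST taken from the tree (`--supports`)

Cell `pub/bsd-wall` (D-0145 line route-BirchSwinnertonDyer-TeichmullerTwistDescent, OPEN rev 2), seat
`bsd-line-ttd-p2` (prover 2/2, g2; holds PSMU 22638). THEOREMS ONLY; every theorem is `proof.conditional`
(cite-only antecedents); nothing is closed; BSD is not proved by this.

Since 2026-08-28T01:04Z L-TWIST is a tree theorem modulo print and one witness:
`LTwist.lTwist_of_iharaSq_of_witness : diamondRibet1997_iharaLemma_sq → hW → hLT` (p591838, seat
bsd-line-edix-p4, assembling edix-p2's `lTwist_core`, edix-p3's non-Eisenstein eigencharacter and the THREE-COPY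
Ihara fact `ModularForms.diamondRibet1997_iharaLemma_sq` (p590882, Diamond–Ribet 1997 Lemma 4.6 / DDT §4.5)), with
`hW` = the Chebotarev witness «for `E[p]` irreducible, `p` odd, `S ≠ 0`: a prime `r₀ ≡ 1 (mod S)`, `r₀ ∤ S`, with
`a_{r₀} ≢ r₀ + 1 (mod p)`» (seat edix-p5 proving it from the tree's Chebotarev; no new fact). Plugging it into
this seat's `…_of_kato_of_periodTwist` closers (p589716 / p590731):

* `not_dvd_c_of_kato_of_iharaSq_of_witness` — **Manin's `p`-part at EVERY lattice-optimal datum of EVERY curve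
  additive at `p ≥ 5` with `E[p]` irreducible, GRANTED {`exists_isNewformOf`, F″, Ihara³, `hW`}.**
* `principalSeriesOptimalManinUnit_of_kato_of_iharaSq_of_witness` (PSMU 22638),
  `supercuspidalOptimalManinUnitFiveSeven_of_kato_of_iharaSq_of_witness` (SCMU57 22639),
  `kummerCornerTorsionOptimalManinUnit_of_kato_of_iharaSq_of_witness` (CORNER 23883),
  `supersingularTorsionOptimalManinUnitFive_of_kato_of_iharaSq_of_witness` (LOW 23884) — the four Manin decls of the
  route from the same four inputs.

HONEST STATUS (numbers): cite-only inputs = 2 (F″ = `kato_neron_isIntegral_twistedSymbolSum_of_additive_five_le`,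
XL, referee-flagged; Ihara³ = `diamondRibet1997_iharaLemma_sq`) + modularity (`exists_isNewformOf`, BCDT) + the
witness `hW` (tree-provable, in flight). PLANNER DATUM (bsd-idea-3): twins «KatoNeronAndCremonaFacts →
PublishedInputsAdditiveKoly → <Ihara³ bundle> → CORNER / LOW» close by `exact` from this file once `hW` is a
theorem (then drop `hW`) — or now, with `hW` as a registered witness item. BSD is not proved by this.
[cite: Kato2004Asterisque, (8.1.3) (p. 180), Thm. 9.7 (p. 189)] [cite: DiamondRibet1997, §4.4 Lemma 4.6]
[cite: DarmonDiamondTaylor1995, Lemma 4.28 (a), §4.5 p. 137] [cite: KostersPannekoek2017, Thm. 1 and Cor. 2]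
[cite: Stevens1989, Lemma (5.2) p. 96, Lemma (5.4) p. 97] [cite: BCDTJAMS2001, Thm. A]
-/

set_option autoImplicit false
-- single-conjunct summit: `Summit.BirchSwinnertonDyer.BirchSwinnertonDyer.…` repeats the name by design
set_option linter.dupNamespace false

noncomputable section

open scoped Classical MatrixGroups

open WeierstrassCurve IsDedekindDomain Rat.HeightOneSpectrum NumberField
  Literature.NumberTheory.EllipticCurves Literature.NumberTheory.EllipticCurves.ModularForms
  Literature.NumberTheory.EllipticCurves.Rank1Residual Literature.NumberTheory.DiophantineGeometry
  Summit.BirchSwinnertonDyer.Rank1Residual Summit.BirchSwinnertonDyer.Rank1Residual.Additive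
  Summit.BirchSwinnertonDyer.BirchSwinnertonDyer.Theses.TeichmullerTwistDescent
  Summit.BirchSwinnertonDyer.BirchSwinnertonDyer.Theorems CongruenceSubgroup

namespace Summit.BirchSwinnertonDyer.BirchSwinnertonDyer.Theorems.TeichmullerTwistDescent

/-- **Manin's `p`-part at EVERY lattice-optimal datum, GRANTED modularity, F″, Ihara³ and the Chebotarev
witness.** For `W/ℚ` globally minimal, additive at `p ≥ 5` with `E[p]` irreducible and `D` lattice-optimal at any
level: `p ∤ c(D)` — `not_dvd_c_of_kato_of_periodTwist` with L-TWIST := `LTwist.lTwist_of_iharaSq_of_witness hI hW`.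
CONDITIONAL (cite-only `hnf`, `hK`, `hI`; `hW` tree-provable, in flight); nothing closed; BSD is not proved by this.
[cite: Kato2004Asterisque, (8.1.3) (p. 180), Thm. 9.7 (p. 189)] [cite: DiamondRibet1997, §4.4 Lemma 4.6]
[cite: KostersPannekoek2017, Thm. 1 and Cor. 2] [cite: Stevens1989, Lemma (5.2) p. 96] -/
theorem not_dvd_c_of_kato_of_iharaSq_of_witness (hnf : exists_isNewformOf)
    (hK : kato_neron_isIntegral_twistedSymbolSum_of_additive_five_le) (hI : diamondRibet1997_iharaLemma_sq)
    (hW : ∀ (W : WeierstrassCurve ℚ) [W.IsElliptic] [W.IsGloballyMinimal] (p : ℕ) [Fact p.Prime] (S : ℕ),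
      p ≠ 2 → Irr W p → S ≠ 0 →
      ∃ r₀ : ℕ, r₀.Prime ∧ ¬ r₀ ∣ S ∧ r₀ ≡ 1 [MOD S] ∧ ¬ (p : ℤ) ∣ W.LFunction r₀ - (r₀ + 1))
    (W : WeierstrassCurve ℚ) [W.IsElliptic] [W.IsGloballyMinimal] (p : ℕ) [Fact p.Prime]
    {N : ℕ} [NeZero N] (D : ModularParametrizationData W N)
    (hp5 : 5 ≤ p) (hadd : Addv W p) (hirr : Irr W p)
    (hlat : ∀ z ∈ D.L.lattice, ∃ w ∈ periodLattice D.f, z = D.c * w) :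
    ¬ (p : ℤ) ∣ D.c :=
  not_dvd_c_of_kato_of_periodTwist hnf hK (LTwist.lTwist_of_iharaSq_of_witness hI hW) W p D hp5 hadd hirr hlat

/-- **PSMU (stmt-BirchSwinnertonDyer-22638) GRANTED modularity, F″, Ihara³ and the Chebotarev witness.**
CONDITIONAL; the item is not closed by this; BSD is not proved by this.
[cite: Kato2004Asterisque, Thm. 9.7 (p. 189)] [cite: DiamondRibet1997, §4.4 Lemma 4.6] -/
theorem principalSeriesOptimalManinUnit_of_kato_of_iharaSq_of_witness (hnf : exists_isNewformOf)
    (hK : kato_neron_isIntegral_twistedSymbolSum_of_additive_five_le) (hI : diamondRibet1997_iharaLemma_sq)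
    (hW : ∀ (W : WeierstrassCurve ℚ) [W.IsElliptic] [W.IsGloballyMinimal] (p : ℕ) [Fact p.Prime] (S : ℕ),
      p ≠ 2 → Irr W p → S ≠ 0 →
      ∃ r₀ : ℕ, r₀.Prime ∧ ¬ r₀ ∣ S ∧ r₀ ≡ 1 [MOD S] ∧ ¬ (p : ℤ) ∣ W.LFunction r₀ - (r₀ + 1)) :
    PrincipalSeriesOptimalManinUnit :=
  principalSeriesOptimalManinUnit_of_kato_of_periodTwist hnf hK (LTwist.lTwist_of_iharaSq_of_witness hI hW)

/-- **SCMU57 (stmt-BirchSwinnertonDyer-22639) GRANTED modularity, F″, Ihara³ and the Chebotarev witness.**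
CONDITIONAL; the item is not closed by this; BSD is not proved by this.
[cite: Kato2004Asterisque, Thm. 9.7 (p. 189)] [cite: DiamondRibet1997, §4.4 Lemma 4.6] -/
theorem supercuspidalOptimalManinUnitFiveSeven_of_kato_of_iharaSq_of_witness (hnf : exists_isNewformOf)
    (hK : kato_neron_isIntegral_twistedSymbolSum_of_additive_five_le) (hI : diamondRibet1997_iharaLemma_sq)
    (hW : ∀ (W : WeierstrassCurve ℚ) [W.IsElliptic] [W.IsGloballyMinimal] (p : ℕ) [Fact p.Prime] (S : ℕ),
      p ≠ 2 → Irr W p → S ≠ 0 →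
      ∃ r₀ : ℕ, r₀.Prime ∧ ¬ r₀ ∣ S ∧ r₀ ≡ 1 [MOD S] ∧ ¬ (p : ℤ) ∣ W.LFunction r₀ - (r₀ + 1)) :
    SupercuspidalOptimalManinUnitFiveSeven :=
  supercuspidalOptimalManinUnitFiveSeven_of_kato_of_periodTwist hnf hK (LTwist.lTwist_of_iharaSq_of_witness hI hW)

/-- **CORNER (stmt-BirchSwinnertonDyer-23883) GRANTED modularity, F″, Ihara³ and the Chebotarev witness** — the
Kosters–Pannekoek corner of the principal series (III@5 / II@7 with a `ℚ_p`-rational point of order `p`), the cell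
the route's untyped NMI/TTC mechanism was aimed at, is reached by Kato's Euler system + the auxiliary unit twist +
Ihara³ instead. CONDITIONAL; the item is not closed by this; BSD is not proved by this.
[cite: Kato2004Asterisque, Thm. 9.7 (p. 189)] [cite: DiamondRibet1997, §4.4 Lemma 4.6] [cite: KostersPannekoek2017, Cor. 2] -/
theorem kummerCornerTorsionOptimalManinUnit_of_kato_of_iharaSq_of_witness (hnf : exists_isNewformOf)
    (hK : kato_neron_isIntegral_twistedSymbolSum_of_additive_five_le) (hI : diamondRibet1997_iharaLemma_sq)
    (hW : ∀ (W : WeierstrassCurve ℚ) [W.IsElliptic] [W.IsGloballyMinimal] (p : ℕ) [Fact p.Prime] (S : ℕ),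
      p ≠ 2 → Irr W p → S ≠ 0 →
      ∃ r₀ : ℕ, r₀.Prime ∧ ¬ r₀ ∣ S ∧ r₀ ≡ 1 [MOD S] ∧ ¬ (p : ℤ) ∣ W.LFunction r₀ - (r₀ + 1)) :
    KummerCornerTorsionOptimalManinUnit :=
  kummerCornerTorsionOptimalManinUnit_of_kato_of_periodTwist hnf hK (LTwist.lTwist_of_iharaSq_of_witness hI hW)

/-- **LOW (stmt-BirchSwinnertonDyer-23884) GRANTED modularity, F″, Ihara³ and the Chebotarev witness.**
CONDITIONAL; the item is not closed by this; BSD is not proved by this.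
[cite: Kato2004Asterisque, Thm. 9.7 (p. 189)] [cite: DiamondRibet1997, §4.4 Lemma 4.6] [cite: KostersPannekoek2017, Cor. 2] -/
theorem supersingularTorsionOptimalManinUnitFive_of_kato_of_iharaSq_of_witness (hnf : exists_isNewformOf)
    (hK : kato_neron_isIntegral_twistedSymbolSum_of_additive_five_le) (hI : diamondRibet1997_iharaLemma_sq)
    (hW : ∀ (W : WeierstrassCurve ℚ) [W.IsElliptic] [W.IsGloballyMinimal] (p : ℕ) [Fact p.Prime] (S : ℕ),
      p ≠ 2 → Irr W p → S ≠ 0 →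
      ∃ r₀ : ℕ, r₀.Prime ∧ ¬ r₀ ∣ S ∧ r₀ ≡ 1 [MOD S] ∧ ¬ (p : ℤ) ∣ W.LFunction r₀ - (r₀ + 1)) :
    SupersingularTorsionOptimalManinUnitFive :=
  supersingularTorsionOptimalManinUnitFive_of_kato_of_periodTwist hnf hK
    (LTwist.lTwist_of_iharaSq_of_witness hI hW)

/-! ### §2 The Chebotarev witness discharged (appended 2026-08-28, same seat): everything GRANTED modularity and
the TWO cite-only facts F″ (Kato) and Ihara³ (Diamond–Ribet) ONLY

`NonEisensteinWitness.lTwistWitness` (`Theorems/EdixhovenFibreFiveSevenNonEisensteinWitness.lean`, seat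
bsd-line-edix-p5) PROVES the witness `hW` verbatim (Chebotarev for the division field, tree theorems only). -/

/-- **Manin's `p`-part at EVERY lattice-optimal datum of EVERY curve additive at `p ≥ 5` with `E[p]` irreducible,
GRANTED modularity, F″ and Ihara³ only** (`hW` := `NonEisensteinWitness.lTwistWitness`). CONDITIONAL on three
cite-only published facts; nothing closed; BSD is not proved by this.
[cite: Kato2004Asterisque, (8.1.3) (p. 180), Thm. 9.7 (p. 189)] [cite: DiamondRibet1997, §4.4 Lemma 4.6]
[cite: BCDTJAMS2001, Thm. A] -/
theorem not_dvd_c_of_kato_of_iharaSq (hnf : exists_isNewformOf)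
    (hK : kato_neron_isIntegral_twistedSymbolSum_of_additive_five_le) (hI : diamondRibet1997_iharaLemma_sq)
    (W : WeierstrassCurve ℚ) [W.IsElliptic] [W.IsGloballyMinimal] (p : ℕ) [Fact p.Prime]
    {N : ℕ} [NeZero N] (D : ModularParametrizationData W N)
    (hp5 : 5 ≤ p) (hadd : Addv W p) (hirr : Irr W p)
    (hlat : ∀ z ∈ D.L.lattice, ∃ w ∈ periodLattice D.f, z = D.c * w) :
    ¬ (p : ℤ) ∣ D.c :=
  not_dvd_c_of_kato_of_iharaSq_of_witness hnf hK hI NonEisensteinWitness.lTwistWitness W p D hp5 hadd hirr hlat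

/-- **PSMU (stmt-BirchSwinnertonDyer-22638) GRANTED modularity, F″ and Ihara³ only.** CONDITIONAL on three cite-only
published facts; the item is not closed by this (the decl carries no antecedent); BSD is not proved by this.
[cite: Kato2004Asterisque, Thm. 9.7 (p. 189)] [cite: DiamondRibet1997, §4.4 Lemma 4.6] -/
theorem principalSeriesOptimalManinUnit_of_kato_of_iharaSq (hnf : exists_isNewformOf)
    (hK : kato_neron_isIntegral_twistedSymbolSum_of_additive_five_le) (hI : diamondRibet1997_iharaLemma_sq) :
    PrincipalSeriesOptimalManinUnit :=
  principalSeriesOptimalManinUnit_of_kato_of_iharaSq_of_witness hnf hK hI NonEisensteinWitness.lTwistWitness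

/-- **SCMU57 (stmt-BirchSwinnertonDyer-22639) GRANTED modularity, F″ and Ihara³ only.** CONDITIONAL; BSD is not
proved by this. [cite: Kato2004Asterisque, Thm. 9.7 (p. 189)] [cite: DiamondRibet1997, §4.4 Lemma 4.6] -/
theorem supercuspidalOptimalManinUnitFiveSeven_of_kato_of_iharaSq (hnf : exists_isNewformOf)
    (hK : kato_neron_isIntegral_twistedSymbolSum_of_additive_five_le) (hI : diamondRibet1997_iharaLemma_sq) :
    SupercuspidalOptimalManinUnitFiveSeven :=
  supercuspidalOptimalManinUnitFiveSeven_of_kato_of_iharaSq_of_witness hnf hK hI NonEisensteinWitness.lTwistWitness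

/-- **CORNER (stmt-BirchSwinnertonDyer-23883) GRANTED modularity, F″ and Ihara³ only.** CONDITIONAL; BSD is not
proved by this. [cite: Kato2004Asterisque, Thm. 9.7 (p. 189)] [cite: DiamondRibet1997, §4.4 Lemma 4.6] -/
theorem kummerCornerTorsionOptimalManinUnit_of_kato_of_iharaSq (hnf : exists_isNewformOf)
    (hK : kato_neron_isIntegral_twistedSymbolSum_of_additive_five_le) (hI : diamondRibet1997_iharaLemma_sq) :
    KummerCornerTorsionOptimalManinUnit :=
  kummerCornerTorsionOptimalManinUnit_of_kato_of_iharaSq_of_witness hnf hK hI NonEisensteinWitness.lTwistWitness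

/-- **LOW (stmt-BirchSwinnertonDyer-23884) GRANTED modularity, F″ and Ihara³ only.** CONDITIONAL; BSD is not proved
by this. [cite: Kato2004Asterisque, Thm. 9.7 (p. 189)] [cite: DiamondRibet1997, §4.4 Lemma 4.6] -/
theorem supersingularTorsionOptimalManinUnitFive_of_kato_of_iharaSq (hnf : exists_isNewformOf)
    (hK : kato_neron_isIntegral_twistedSymbolSum_of_additive_five_le) (hI : diamondRibet1997_iharaLemma_sq) :
    SupersingularTorsionOptimalManinUnitFive :=
  supersingularTorsionOptimalManinUnitFive_of_kato_of_iharaSq_of_witness hnf hK hI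
    NonEisensteinWitness.lTwistWitness

/-- **CORNER from the route's REGISTERED PUB bundles plus Ihara³**: `KatoNeronAndCremonaFacts` (23789; F″),
`PublishedInputsAdditiveKoly` (20137; modularity) and the cite-only `diamondRibet1997_iharaLemma_sq` — the shape
a twin «KatoNeronAndCremonaFacts → PublishedInputsAdditiveKoly → IharaBundle → KummerCornerTorsionOptimalManinUnit»
closes by `exact`. CONDITIONAL; BSD is not proved by this. [cite: DiamondRibet1997, §4.4 Lemma 4.6] -/
theorem kummerCornerTorsionOptimalManinUnit_of_pubBundles_of_iharaSq (hKC : KatoNeronAndCremonaFacts)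
    (hP : PublishedInputsAdditiveKoly) (hI : diamondRibet1997_iharaLemma_sq) :
    KummerCornerTorsionOptimalManinUnit :=
  kummerCornerTorsionOptimalManinUnit_of_kato_of_iharaSq hP.2.2.2.2.2.1 hKC.1 hI

/-- **LOW from the REGISTERED PUB bundles plus Ihara³.** CONDITIONAL; BSD is not proved by this.
[cite: DiamondRibet1997, §4.4 Lemma 4.6] -/
theorem supersingularTorsionOptimalManinUnitFive_of_pubBundles_of_iharaSq (hKC : KatoNeronAndCremonaFacts)
    (hP : PublishedInputsAdditiveKoly) (hI : diamondRibet1997_iharaLemma_sq) :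
    SupersingularTorsionOptimalManinUnitFive :=
  supersingularTorsionOptimalManinUnitFive_of_kato_of_iharaSq hP.2.2.2.2.2.1 hKC.1 hI

/-- **PSMU from the REGISTERED PUB bundles plus Ihara³** (no CORNER, no GE11, no `PublishedManinFacts`).
CONDITIONAL; BSD is not proved by this. [cite: DiamondRibet1997, §4.4 Lemma 4.6] -/
theorem principalSeriesOptimalManinUnit_of_pubBundles_of_iharaSq (hKC : KatoNeronAndCremonaFacts)
    (hP : PublishedInputsAdditiveKoly) (hI : diamondRibet1997_iharaLemma_sq) :
    PrincipalSeriesOptimalManinUnit :=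
  principalSeriesOptimalManinUnit_of_kato_of_iharaSq hP.2.2.2.2.2.1 hKC.1 hI

/-- **SCMU57 from the REGISTERED PUB bundles plus Ihara³** (no LOW). CONDITIONAL; BSD is not proved by this.
[cite: DiamondRibet1997, §4.4 Lemma 4.6] -/
theorem supercuspidalOptimalManinUnitFiveSeven_of_pubBundles_of_iharaSq (hKC : KatoNeronAndCremonaFacts)
    (hP : PublishedInputsAdditiveKoly) (hI : diamondRibet1997_iharaLemma_sq) :
    SupercuspidalOptimalManinUnitFiveSeven :=
  supercuspidalOptimalManinUnitFiveSeven_of_kato_of_iharaSq hP.2.2.2.2.2.1 hKC.1 hI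

end Summit.BirchSwinnertonDyer.BirchSwinnertonDyer.Theorems.TeichmullerTwistDescent

end
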